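import Summits.QuantumFields.YangMills.Theorems.UnitScaleTiltProp7CoverCombLetters
import Summits.QuantumFields.YangMills.Theorems.UnitScaleTiltProp7SymAvgTwDefs
import Summits.QuantumFields.YangMills.Theorems.UnitScaleTiltProp7ChartSigmaT3Descent
import HarnessLib

/-!
# Route `UnitScaleTilt`, crux K1 «MinimiserStabilityRegPr» (stmt-QuantumFields-19200), route-R E′ (N06) LANE II (★★OWNER RULING №23), brick (C5-a) «LIFT TO A COVER»
# (★p1 g19 NAMER WORDS №1∕№3∕№5), FILE F4a of px12 g7's LOCATE `LOCATE-C5a-COVERLIFT-px12g7.md` §2: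
# **THE TWISTED CHART IS NATURAL UNDER THE `L^{jc}`-FOLD COVER, AS A FUNCTION** — the accumulated frame (85) is translation covariant (`wrec_shiftCfg`, the (r1) lemma), so
# `frameTw (F.cover jc) (W∘π) (A∘π) y′ = frameTw F W A (π y′)`; the complexified (0.4) tower is natural (`iterGL_comp_projBond`, `descendToGL_cover`); hence
# `dbarTw` and **`logChartTw (F.cover jc) (W∘π) (A∘π) = (logChartTw F W A) ∘ π`** EXACTLY, for every background and every `A` (no regularity)

Cell `ym3-torus` (HUMAN RULING D-0037, YM ladder rung R3 — YM₃ on T³ is a rung, NOT d = 4, NOT infinite volume, NOT a mass gap, NOT Clay; YM gap NOT proved), width seat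
`ym3-torus-px12` (gen 7).  THEOREMS ONLY (0 `def`, 0 `sorry`); `--supports stmt-QuantumFields-19200 --as helper`; count-neutral.  Bookkeeping over lit ✓`B7TranslationCovariance`
(`tHol_shiftCfg`, `shiftCfg_avgIter`), ✓`Prop7ChartSigmaT3Descent` (`savg_shiftCfg`, `R0fun_shiftCfg`, `tildIter_shiftCfg`), ✓`…HalvingSmallMembersCoverLift` (`holT_comp_projBond`,
`fieldShift_comp_projBond`), FILE F3 (`proj_basePt`, `proj_transl`); nothing of (V3)∕`hN06`∕the crux is claimed.  The Fréchet-derivative step `QTw`∕`Qkc` (chain rule on `RegPr`) is FILE F4b.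

References: T. Bałaban, CMP 98 (1985) 17–51 [Balaban1985Averaging] ((43) p.24, (79)–(80) p.30, (82) p.30, (85)–(89) p.31); CMP 109 (1987) 249–301 [Balaban1987RG1] ((0.1)–(0.4) pp.251–253);
CMP 100 (1985) [Balaban1985RegularSpaces] ((1.31) p.82).
-/

noncomputable section

open scoped Matrix.Norms.L2Operator BigOperators

namespace Summit.QuantumFields.YangMills.Theorems.Prop7CoverTwistedChart

open NormedSpace
open Literature.MathematicalPhysics.QuantumFieldTheory.Balaban1983to89
open Literature.MathematicalPhysics.QuantumFieldTheory.Balaban1983to89.T3ContinuumYM3Torus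
open T3LevelShift (siteShift siteShift_apply coordEquiv_val fieldShift)
open T3PrintedRegularOrbits (sites_eq)
open T3SectALandauChart (bgUnits)
open T4Continuum BlockAveraging
open B7Prop1Explicit renaming Site → LSite
open B7Prop1Explicit (expUnit treeWord)
open B7Prop2Explicit (avgIter)
open B7Eq92Concrete (tHol tildIter)
open B7Eq99Concrete (wrec wrec_succ R0fun savg)
open B7TranslationCovariance (tHol_shiftCfg shiftCfg_avgIter)
open B10Eq27TorusAxialLog (holT pull transl)
open B12Ineq417Flat (shiftCfg shiftCfg_apply)
open MatrixLog (mlog)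
open CoverSites
open Summit.QuantumFields.YangMills.Theorems.Prop7SPrint (basePt)
open Summit.QuantumFields.YangMills.Theorems.Prop7SymAvgGL (loopHolGL straightGL meanLogGL avgFunGL iterGL descendToGL iterGL_zero iterGL_succ avgFunGL_apply)
open Summit.QuantumFields.YangMills.Theorems.Prop7SymAvgTw (coordT3 frameTw dbarTw logChartTw coordT3_apply frameTw_def dbarTw_def logChartTw_apply)
open Summit.QuantumFields.YangMills.Theorems.Prop7ChartSigmaT3Descent (savg_shiftCfg R0fun_shiftCfg tildIter_shiftCfg)
open Summit.QuantumFields.YangMills.Theorems.SmallMembersCoverLift (holT_comp_projBond fieldShift_comp_projBond)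
open Summit.QuantumFields.YangMills.Theorems.Prop7CoverCombLetters (proj_basePt proj_transl)
open Summit.QuantumFields.YangMills.Theorems.Prop7LandauCombDict (isPeriodic_pull)
open Summit.QuantumFields.YangMills.Theorems.Prop7QprimeCombL2 (sitesPerDir_zero_eq)

/-! ## §1 (r1) The accumulated frame (85) is translation covariant -/

section Frame

variable {d : ℕ} {𝔸 : Type*} [NormedRing 𝔸] [NormedAlgebra ℂ 𝔸] [CompleteSpace 𝔸]

/-- ★★ **(85) IS TRANSLATION COVARIANT**: translating both configurations on the fine lattice by `Lʲa` translates the accumulated frame `w_j` on the `j`-lattice by `a`: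
`wrec L (t_{Lʲa}U₀) (t_{Lʲa}U₁) j z = wrec L U₀ U₁ j (z + a)` (induction on `j` with ✓`savg_shiftCfg`, ✓`tHol_shiftCfg`, ✓`tildIter_shiftCfg`, ✓`shiftCfg_avgIter`, ✓`R0fun_shiftCfg`).
[cite: Balaban1985Averaging, (85) p.31, (79)-(80) p.30, (43) p.24] -/
theorem wrec_shiftCfg (L : ℕ) (U₀ U₁ : LSite d → Fin d → 𝔸ˣ) :
    ∀ (j : ℕ) (a z : LSite d), wrec L (shiftCfg (((L : ℤ) ^ j) • a) U₀) (shiftCfg (((L : ℤ) ^ j) • a) U₁) j z = wrec L U₀ U₁ j (z + a)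
  | 0, a, z => by simp [wrec]
  | j + 1, a, z => by
    rw [wrec_succ, wrec_succ, smul_add]
    have hU : avgIter L (shiftCfg (((L : ℤ) ^ (j + 1)) • a) U₀) j = shiftCfg ((L : ℤ) • a) (avgIter L U₀ j) := by
      rw [shiftCfg_avgIter, smul_smul, ← pow_succ]
    have hT : tildIter L (shiftCfg (((L : ℤ) ^ (j + 1)) • a) U₀) (shiftCfg (((L : ℤ) ^ (j + 1)) • a) U₁) j = shiftCfg ((L : ℤ) • a) (tildIter L U₀ U₁ j) := by
      funext x κ
      rw [shiftCfg_apply, ← tildIter_shiftCfg L U₀ U₁ j ((L : ℤ) • a) x κ, smul_smul, ← pow_succ]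
    have hw : wrec L (shiftCfg (((L : ℤ) ^ (j + 1)) • a) U₀) (shiftCfg (((L : ℤ) ^ (j + 1)) • a) U₁) j = shiftCfg ((L : ℤ) • a) (wrec L U₀ U₁ j) := by
      funext x
      rw [shiftCfg_apply, ← wrec_shiftCfg L U₀ U₁ j ((L : ℤ) • a) x, smul_smul, ← pow_succ]
    rw [hU, hT, hw, R0fun_shiftCfg]
    have hfun : (fun x => tHol (shiftCfg ((L : ℤ) • a) (avgIter L U₀ j)) (shiftCfg ((L : ℤ) • a) (tildIter L U₀ U₁ j)) ((L : ℤ) • z) (treeWord (x - (L : ℤ) • z))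
          * shiftCfg ((L : ℤ) • a) (R0fun (avgIter L U₀ j) ((L : ℤ) • z + (L : ℤ) • a) (wrec L U₀ U₁ j)) x)
        = shiftCfg ((L : ℤ) • a) (fun x => tHol (avgIter L U₀ j) (tildIter L U₀ U₁ j) ((L : ℤ) • z + (L : ℤ) • a) (treeWord (x - ((L : ℤ) • z + (L : ℤ) • a)))
          * R0fun (avgIter L U₀ j) ((L : ℤ) • z + (L : ℤ) • a) (wrec L U₀ U₁ j) x) := by
      funext x
      rw [shiftCfg_apply, shiftCfg_apply, tHol_shiftCfg]
      congr 2
      abel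
    rw [hfun, savg_shiftCfg]

/-- Hence `w_j` IS `Q`-PERIODIC for `LʲQ`-periodic data. [cite: Balaban1985Averaging, (85) p.31; Balaban1985RegularSpaces, p.77] -/
theorem wrec_add_period (L : ℕ) {U₀ U₁ : LSite d → Fin d → 𝔸ˣ} {j : ℕ} {Q : ℕ} {m : LSite d} (h₀ : shiftCfg (((L : ℤ) ^ j) • ((Q : ℤ) • m)) U₀ = U₀)
    (h₁ : shiftCfg (((L : ℤ) ^ j) • ((Q : ℤ) • m)) U₁ = U₁) (z : LSite d) :
    wrec L U₀ U₁ j (z + (Q : ℤ) • m) = wrec L U₀ U₁ j z := by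
  have h := wrec_shiftCfg L U₀ U₁ j ((Q : ℤ) • m) z
  rw [h₀, h₁] at h
  exact h.symm

end Frame

/-! ## §2 `frameTw` of the lift is the lift of `frameTw` -/

variable (F : T3Family) (jc : ℕ) {n K : ℕ} (h : n ≤ K)

/-- The canonical coordinates of a cover site and of its projection differ by a multiple of the period: `coordT3′ y′ = coordT3 (π y′) + N_k • q`.
[cite: Balaban1987RG1, (0.1) p.251] -/
theorem coordT3_cover_eq (y : Site ((F.cover jc).P n) 0) :
    ∃ q : LSite (F.P K).d, coordT3 (F.cover jc) n K h y = coordT3 F n K h (proj (F.P n) jc 0 y) + (((F.P n).sitesPerDir 0 : ℕ) : ℤ) • q := by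
  refine ⟨fun μ => (((y μ).val / (F.P n).sitesPerDir 0 : ℕ) : ℤ), ?_⟩
  funext μ
  have e1 : coordT3 (F.cover jc) n K h y μ = ((y μ).val : ℤ) := congrArg (fun t : ℕ => (t : ℤ)) (coordEquiv_val _ (y μ))
  have e2 : coordT3 F n K h (proj (F.P n) jc 0 y) μ = (((y μ).val % (F.P n).sitesPerDir 0 : ℕ) : ℤ) :=
    (congrArg (fun t : ℕ => (t : ℤ)) (coordEquiv_val _ (proj (F.P n) jc 0 y μ))).trans (congrArg (fun t : ℕ => (t : ℤ)) (val_proj (F.P n) jc 0 y μ))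
  rw [Pi.add_apply, e1, e2, Pi.smul_apply, smul_eq_mul]
  have hdm := Nat.mod_add_div (y μ).val ((F.P n).sitesPerDir 0)
  exact_mod_cast hdm.symm

include h in
/-- ★ The pulled-back perturbation of the lift is the pulled-back perturbation (as ℤ³ configurations; any `V`). [cite: Balaban1985Averaging, (9) p.18; Balaban1987RG1, (0.1) p.251] -/
theorem pull_cover {G : Type*} (V : GaugeField (F.P K) 0 G) :
    pull (V ∘ projBond (F.P K) jc 0) (basePt (F.cover jc) n K) = pull V (basePt F n K) := by
  funext z μ
  rw [B10Eq27TorusAxialLog.pull_apply, B10Eq27TorusAxialLog.pull_apply]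
  show V (projBond (F.P K) jc 0 ⟨transl (basePt (F.cover jc) n K) z, μ⟩) = V ⟨transl (basePt F n K) z, μ⟩
  rw [← proj_basePt F jc n K h, ← proj_transl]
  rfl

/-- ★★ **THE ACCUMULATED FRAME OF THE LIFT IS THE LIFT OF THE ACCUMULATED FRAME**: `frameTw (F.cover jc) (W∘π) (A∘π) y′ = frameTw F W A (π y′)` (the ℤ³ data coincide; the coordinates
differ by a period of `w_k`). [cite: Balaban1985Averaging, (85) p.31, (87) p.31; Balaban1987RG1, (0.1) p.251] -/
theorem frameTw_cover (W : GaugeField (F.P K) 0 (Matrix.specialUnitaryGroup (Fin 2) ℂ)) (A : PBond (F.P K) 0 → Matrix (Fin 2) (Fin 2) ℂ) (y : Site ((F.cover jc).P n) 0) :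
    frameTw (F.cover jc) n K h (W ∘ projBond (F.P K) jc 0) (A ∘ projBond (F.P K) jc 0) y = frameTw F n K h W A (proj (F.P n) jc 0 y) := by
  rw [frameTw_def, frameTw_def]
  have hW : pull (bgUnits (F.cover jc) K (W ∘ projBond (F.P K) jc 0)) (basePt (F.cover jc) n K) = pull (bgUnits F K W) (basePt F n K) := pull_cover F jc h (bgUnits F K W)
  have hA : pull (fun b => expUnit ((A ∘ projBond (F.P K) jc 0) b)) (basePt (F.cover jc) n K) = pull (fun b => expUnit (A b)) (basePt F n K) :=
    pull_cover F jc h (fun b => expUnit (A b))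
  obtain ⟨q, hq⟩ := coordT3_cover_eq F jc h y
  have hre : wrec ((F.cover jc).P K).L (pull (bgUnits (F.cover jc) K (W ∘ projBond (F.P K) jc 0)) (basePt (F.cover jc) n K))
        (pull (fun b => expUnit ((A ∘ projBond (F.P K) jc 0) b)) (basePt (F.cover jc) n K)) (K - n) (coordT3 (F.cover jc) n K h y)
      = wrec (F.P K).L (pull (bgUnits F K W) (basePt F n K)) (pull (fun b => expUnit (A b)) (basePt F n K)) (K - n)
          (coordT3 F n K h (proj (F.P n) jc 0 y) + (((F.P n).sitesPerDir 0 : ℕ) : ℤ) • q) := by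
    rw [hq]
    exact congrArg₂ (fun a b => wrec (F.P K).L a b (K - n) (coordT3 F n K h (proj (F.P n) jc 0 y) + (((F.P n).sitesPerDir 0 : ℕ) : ℤ) • q)) hW hA
  -- `w_k` is `N_k`-periodic: the pulled-back data are `N₀ = Lᵏ N_k`-periodic
  have hNn : (F.P n).sitesPerDir 0 = (F.P K).sitesPerDir (K - n) := sites_eq F n K h
  have hNN : ((F.P K).L : ℤ) ^ (K - n) * (((F.P n).sitesPerDir 0 : ℕ) : ℤ) = (((F.P K).sitesPerDir 0 : ℕ) : ℤ) := by
    rw [hNn, sitesPerDir_zero_eq F n K h]; push_cast; ring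
  have hper : ∀ (V : LSite (F.P K).d → Fin (F.P K).d → (Matrix (Fin 2) (Fin 2) ℂ)ˣ), T4TermwiseTorus.IsPeriodic ((F.P K).sitesPerDir 0) V →
      shiftCfg ((((F.P K).L : ℤ) ^ (K - n)) • ((((F.P n).sitesPerDir 0 : ℕ) : ℤ) • q)) V = V := by
    intro V hV
    funext z
    rw [shiftCfg_apply, smul_smul, hNN]
    exact hV z q
  exact hre.trans (wrec_add_period (F.P K).L (hper _ (isPeriodic_pull (bgUnits F K W) (basePt F n K)))
    (hper _ (isPeriodic_pull (fun b => expUnit (A b)) (basePt F n K))) _)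

/-! ## §3 The complexified (0.4) tower and the descent of the lift -/

section Tower

variable (P : Params) (jc : ℕ)

/-- The loop variables of the lift are the loop variables at the projected bond. [cite: Balaban1987RG1, (0.4) p.253] -/
theorem loopHolGL_comp_projBond {j : ℕ} (hj : j + 1 ≤ P.m + P.K) (U : GaugeField P j (Matrix (Fin 2) (Fin 2) ℂ)ˣ) (c : PBond (cover P jc) (j + 1)) (i : Idx P) :
    loopHolGL (U ∘ projBond P jc j) c i = loopHolGL U (projBond P jc (j + 1) c) i := by
  unfold Prop7SymAvgGL.loopHolGL
  rw [holT_comp_projBond, proj_emb P jc j hj]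
  rfl

/-- The straight transporters of the lift are those at the projected bond. [cite: Balaban1987RG1, (0.4) p.253] -/
theorem straightGL_comp_projBond {j : ℕ} (hj : j + 1 ≤ P.m + P.K) (U : GaugeField P j (Matrix (Fin 2) (Fin 2) ℂ)ˣ) (c : PBond (cover P jc) (j + 1)) :
    straightGL (U ∘ projBond P jc j) c = straightGL U (projBond P jc (j + 1) c) := by
  unfold Prop7SymAvgGL.straightGL
  rw [holT_comp_projBond, proj_emb P jc j hj]
  rfl

/-- ★ The complexified one-step average (0.4) of the lift is the lift of the average. [cite: Balaban1987RG1, (0.4) p.253] -/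
theorem avgFunGL_comp_projBond {j : ℕ} (hj : j + 1 ≤ P.m + P.K) (U : GaugeField P j (Matrix (Fin 2) (Fin 2) ℂ)ˣ) :
    avgFunGL (U ∘ projBond P jc j) = avgFunGL U ∘ projBond P jc (j + 1) := by
  funext c
  rw [Function.comp_apply, avgFunGL_apply, avgFunGL_apply, straightGL_comp_projBond P jc hj]
  congr 2
  unfold Prop7SymAvgGL.meanLogGL
  congr 1
  funext i
  rw [loopHolGL_comp_projBond P jc hj]

/-- ★★ The `k`-fold complexified average of the lift is the lift of the `k`-fold average (`k ≤ m + K`). [cite: Balaban1987RG1, (0.4)+(0.11) p.253] -/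
theorem iterGL_comp_projBond (U : GaugeField P 0 (Matrix (Fin 2) (Fin 2) ℂ)ˣ) :
    ∀ k : ℕ, k ≤ P.m + P.K → iterGL k (U ∘ projBond P jc 0) = iterGL k U ∘ projBond P jc k
  | 0, _ => rfl
  | k + 1, hk => by
    rw [iterGL_succ, iterGL_succ, iterGL_comp_projBond U k (by omega)]
    exact avgFunGL_comp_projBond P jc hk (iterGL k U)

end Tower

/-- ★★ **THE COMPLEXIFIED DESCENT OF THE LIFT IS THE LIFT OF THE DESCENT**: `descendToGL (F.cover jc) (U ∘ π) = (descendToGL F U) ∘ π`. [cite: Balaban1987RG1, (0.4) p.253; Balaban1985UV3, (1)-(3) p.256] -/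
theorem descendToGL_cover (U : GaugeField (F.P K) 0 (Matrix (Fin 2) (Fin 2) ℂ)ˣ) :
    descendToGL (F.cover jc) n K h (U ∘ projBond (F.P K) jc 0) = descendToGL F n K h U ∘ projBond (F.P n) jc 0 := by
  unfold Prop7SymAvgGL.descendToGL
  have hk : K - n ≤ (F.P K).m + (F.P K).K := by show K - n ≤ F.m + K; omega
  have hit : iterGL (K - n) (U ∘ projBond (F.P K) jc 0) = iterGL (K - n) U ∘ projBond (F.P K) jc (K - n) := iterGL_comp_projBond (F.P K) jc U (K - n) hk
  exact (congrArg _ hit).trans (fieldShift_comp_projBond jc F _ _ _)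

/-! ## §4 The twisted chart of the lift is the lift of the twisted chart (EXACT, every background, every `A`) -/

/-- Congruence of the (89)-shaped product `X⁻¹·D·T·E⁻¹` in its four letters. [folklore] -/
theorem dbar_congr {G : Type*} [Group G] {X₁ X₂ D₁ D₂ T₁ T₂ E₁ E₂ : G} (hX : X₁ = X₂) (hD : D₁ = D₂) (hT : T₁ = T₂) (hE : E₁ = E₂) :
    X₁⁻¹ * D₁ * T₁ * E₁⁻¹ = X₂⁻¹ * D₂ * T₂ * E₂⁻¹ := by
  subst hX hD hT hE; rfl

/-- ★★ `dbarTw (F.cover jc) (W∘π) (A∘π) c′ = dbarTw F W A (π c′)`. [cite: Balaban1985Averaging, (89) p.31; Balaban1987RG1, (0.1) p.251] -/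
theorem dbarTw_cover (W : GaugeField (F.P K) 0 (Matrix.specialUnitaryGroup (Fin 2) ℂ)) (A : PBond (F.P K) 0 → Matrix (Fin 2) (Fin 2) ℂ) (c : PBond ((F.cover jc).P n) 0) :
    dbarTw (F.cover jc) n K h (W ∘ projBond (F.P K) jc 0) (A ∘ projBond (F.P K) jc 0) c = dbarTw F n K h W A (projBond (F.P n) jc 0 c) := by
  rw [dbarTw_def, dbarTw_def, frameTw_cover F jc h, frameTw_cover F jc h]
  have h1 : descendToGL (F.cover jc) n K h (fun b => expUnit ((A ∘ projBond (F.P K) jc 0) b) * bgUnits (F.cover jc) K (W ∘ projBond (F.P K) jc 0) b) c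
      = descendToGL F n K h (fun b => expUnit (A b) * bgUnits F K W b) (projBond (F.P n) jc 0 c) :=
    congrFun (descendToGL_cover F jc h (fun b => expUnit (A b) * bgUnits F K W b)) c
  have h2 : descendToGL (F.cover jc) n K h (bgUnits (F.cover jc) K (W ∘ projBond (F.P K) jc 0)) c = descendToGL F n K h (bgUnits F K W) (projBond (F.P n) jc 0 c) :=
    congrFun (descendToGL_cover F jc h (bgUnits F K W)) c
  have h3 : frameTw F n K h W A (proj (F.P n) jc 0 c.tgt) = frameTw F n K h W A (projBond (F.P n) jc 0 c).tgt :=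
    congrArg _ (projBond_tgt (F.P n) jc 0 c).symm
  exact dbar_congr rfl h1 h3 h2

/-- ★★★ **`logChartTw (F.cover jc) (W∘π) (A∘π) = (logChartTw F W A) ∘ π`** — the twisted log-chart is natural under the cover, as a FUNCTION of `A` (no regularity, no derivative).
[cite: Balaban1985RegularSpaces, (1.31) p.82; Balaban1985BackgroundPropagators, (3.13)-(3.14) p.393; Balaban1987RG1, (0.1) p.251] -/
theorem logChartTw_cover (W : GaugeField (F.P K) 0 (Matrix.specialUnitaryGroup (Fin 2) ℂ)) (A : PBond (F.P K) 0 → Matrix (Fin 2) (Fin 2) ℂ) :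
    logChartTw (F.cover jc) n K h (W ∘ projBond (F.P K) jc 0) (A ∘ projBond (F.P K) jc 0) = logChartTw F n K h W A ∘ projBond (F.P n) jc 0 := by
  funext c
  rw [logChartTw_apply, Function.comp_apply, logChartTw_apply, dbarTw_cover F jc h]

end Summit.QuantumFields.YangMills.Theorems.Prop7CoverTwistedChart

end
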